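import Summits.QuantumFields.GaugeBoot.Rows.KZL2rpD3LTab
import HarnessLib

/-!
# Gauge-boot: kernel check of the raw `link1` class table of the kz-L2-rp-3D problems, rows 31–62 (part 2/6)

Cell `pub-gaugeboot` (HOME `run/shared/lean/pub/pub-gaugeboot/`), seat lean1 (torus positivity layer for rows C15–C19, C34–C40 (+ the w1x2 / w1x3 / w2x2 windows of the same family) =
the certified kz-L2-rp-3D windows: label set, reflection lines, class/witness tables, the reduction identity; Hermitian half transported from `KZL2HD3`).

HONEST FRAMING (page 1 of every file of this cell): certified bounds on lattice expectations at STATED coupling,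
gauge group, dimension and torus size; NOT a mass gap, NOT a continuum limit, NOT a string tension, NOT large `N`.
The venture is explicitly NOT Yang–Mills-summit-bearing (barriers `FixedCouplingUltralocality`,
`PerturbativeInvisibility`).

`lcanon_rows_<lo>_<hi> : ∀ i, lo ≤ i < hi → ∀ j ≥ i, KZL2rpD3.LCanonOK i j`, each range one closed computation (`decide +kernel`,
≤ 900 entries per theorem — farm calibration for D = 3 reflection words); assembled in `KZL2rpD3Red`.
-/

noncomputable section

open Literature.MathematicalPhysics.QuantumFieldTheory

namespace Summit.QuantumFields.GaugeBoot

namespace KZL2rpD3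

set_option maxHeartbeats 0 in
/-- Rows `31 ≤ i < 35` of the `link1` class table of the kz-L2-rp-3D problems canonicalise (1074 entries; kernel). -/
theorem lcanon_rows_31_35 : ∀ i : Fin 301, 31 ≤ i.val → i.val < 35 → ∀ j : Fin 301, i.val ≤ j.val → KZL2rpD3.LCanonOK i j := by
  decide +kernel

set_option maxHeartbeats 0 in
/-- Rows `35 ≤ i < 39` of the `link1` class table of the kz-L2-rp-3D problems canonicalise (1058 entries; kernel). -/
theorem lcanon_rows_35_39 : ∀ i : Fin 301, 35 ≤ i.val → i.val < 39 → ∀ j : Fin 301, i.val ≤ j.val → KZL2rpD3.LCanonOK i j := by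
  decide +kernel

set_option maxHeartbeats 0 in
/-- Rows `39 ≤ i < 43` of the `link1` class table of the kz-L2-rp-3D problems canonicalise (1042 entries; kernel). -/
theorem lcanon_rows_39_43 : ∀ i : Fin 301, 39 ≤ i.val → i.val < 43 → ∀ j : Fin 301, i.val ≤ j.val → KZL2rpD3.LCanonOK i j := by
  decide +kernel

set_option maxHeartbeats 0 in
/-- Rows `43 ≤ i < 47` of the `link1` class table of the kz-L2-rp-3D problems canonicalise (1026 entries; kernel). -/
theorem lcanon_rows_43_47 : ∀ i : Fin 301, 43 ≤ i.val → i.val < 47 → ∀ j : Fin 301, i.val ≤ j.val → KZL2rpD3.LCanonOK i j := by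
  decide +kernel

set_option maxHeartbeats 0 in
/-- Rows `47 ≤ i < 51` of the `link1` class table of the kz-L2-rp-3D problems canonicalise (1010 entries; kernel). -/
theorem lcanon_rows_47_51 : ∀ i : Fin 301, 47 ≤ i.val → i.val < 51 → ∀ j : Fin 301, i.val ≤ j.val → KZL2rpD3.LCanonOK i j := by
  decide +kernel

set_option maxHeartbeats 0 in
/-- Rows `51 ≤ i < 55` of the `link1` class table of the kz-L2-rp-3D problems canonicalise (994 entries; kernel). -/
theorem lcanon_rows_51_55 : ∀ i : Fin 301, 51 ≤ i.val → i.val < 55 → ∀ j : Fin 301, i.val ≤ j.val → KZL2rpD3.LCanonOK i j := by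
  decide +kernel

set_option maxHeartbeats 0 in
/-- Rows `55 ≤ i < 59` of the `link1` class table of the kz-L2-rp-3D problems canonicalise (978 entries; kernel). -/
theorem lcanon_rows_55_59 : ∀ i : Fin 301, 55 ≤ i.val → i.val < 59 → ∀ j : Fin 301, i.val ≤ j.val → KZL2rpD3.LCanonOK i j := by
  decide +kernel

set_option maxHeartbeats 0 in
/-- Rows `59 ≤ i < 63` of the `link1` class table of the kz-L2-rp-3D problems canonicalise (962 entries; kernel). -/
theorem lcanon_rows_59_63 : ∀ i : Fin 301, 59 ≤ i.val → i.val < 63 → ∀ j : Fin 301, i.val ≤ j.val → KZL2rpD3.LCanonOK i j := by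
  decide +kernel

end KZL2rpD3

end Summit.QuantumFields.GaugeBoot

end
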